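import Summits.RiemannHypothesis.RiemannHypothesis.Theorems.PfPersistenceAMPOddLevelWall
import HarnessLib

/-!
# PF persistence (pf seat, gen 4) — THE KINETIC FORM OF THE SATURATION WEIGHT: `μ_geom ≈ 1/(4‖u′‖²)`

Unit `pub-rhpf-pf-g4` of the `pub-rhpf` cell (mechanism / rigidity campaign; **no RH claims**).
Helper file in support of the cell's target item `EvenOneSignedWindows`; nothing here is a statement about `ζ`.

`PfPersistenceAMPSaturation` (9d62f6294102) proved that in the edge channel the AMP threshold of the even window
block saturates the odd-level wall to the fraction `1/(1 + μ)`, and that at the even level the weight is the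
macroscopic number `μ_geom = −‖u‖²⟪c, Dψ₁⟫/(p⟪u, Dψ₁⟫)` (`p = ⟪c, u⟫`; `u` the even ground state, `ψ₁` the odd
ground state, `c` the polar vector, `D` the Galerkin derivative odd → even).  This file reduces `μ_geom` to ONE
familiar quantity.  Three exact Galerkin rules are taken as hypotheses (each holds TERMWISE in the window's
cosine/sine bases, because odd modes vanish at the edge `x = ±a`; they are the weak forms of
`(cosh ½x)′ = ½ sinh ½x`, of `⟪u, ψ′⟫ = ⟪−u′, ψ⟫`, and of `(sinh ½x · 𝟙_[−a,a])′ = ½ cosh ½x · 𝟙 − sinh ½a (δ_a + δ_{−a})`):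

* (R1) `⟪c, Dψ⟫ = −½⟪σ, ψ⟫` for all odd `ψ` — `σ` is the ODD POLAR VECTOR (`Q⁻ = A₀⁻ + 2|σ⟩⟨σ|`, the
  `sinh ½x` channel of the pole pair);
* (R2) `⟪u, Dψ⟫ = ⟪w, ψ⟫` for all odd `ψ` — `w` is `−u′`, the derivative of the even ground state, so that
  `‖w‖² = ⟪u, Dw⟫` is its KINETIC (Dirichlet) ENERGY (`kinetic_eq`);
* (R3) `Dσ = ½c − 2·sh·δ_a` with `sh = sinh ½a` and `δ_a` the even edge vector.

**PROVED (abstract real inner-product spaces).**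
* `inner_oddPolar_transfer` — (R2)+(R3): `⟪σ, w⟫ = ½p − 2·sh·θ`, `θ = ⟪δ_a, u⟫` the edge value of `u`.
* `muGeom_eq_polarRatio` — (R1)+(R2): `μ_geom = ‖u‖²⟪σ, ψ⟫/(2p⟪w, ψ⟫)`: the weight is
  (odd polar overlap)/(2 · even polar overlap · parity-transfer overlap).
* `muGeom_transfer_exact` — if the odd ground state IS the normalised derivative of the even one (`ψ = t·w`,
  exact PARITY TRANSFER) then `μ_geom = ‖u‖²(1 − 4·sh·θ/p)/(4‖w‖²)`: up to the exponentially small edge term,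
  `μ_geom = 1/(4K)`, `K = ‖u′‖²/‖u‖²` the Rayleigh kinetic energy of the even ground state, and the `¼` is the
  square of the polar exponent `½` (the pole of `ζ` at `s = 1` seen from the critical line).  The polar overlaps
  `p`, `⟪σ, ψ⟫` CANCEL.
* `muGeom_transfer_defect` / `muGeom_transfer_bound` — with a transfer defect `ψ = t·w + r`, `⟪w, r⟫ = 0`:
  `μ_geom·4‖w‖² = ‖u‖²(1 − 4·sh·θ/p + 2⟪σ, r⟫/(t·p))` exactly, hence
  `|μ_geom·4‖w‖² − ‖u‖²(1 − 4·sh·θ/p)| ≤ 2‖u‖²‖σ‖‖r‖/(|t|·|p|)` (Cauchy–Schwarz).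

So, combined with the saturation law: in the edge channel the AMP threshold is
`s* = (ε₁⁻ + μ ε₁⁺)/(1 + μ)` with `μ = (1 + O(defect))/(4K)`, i.e. **`t*/WALL = 4K/(1 + 4K)`** to that accuracy.

**DATA (ζ windows; engine B series blocks, 60–80 digits; this seat's `musweep/ibp.py`; DATA-probe, not certified).**
(R1), (R2), (R3) hold to all printed digits (they are termwise identities); the parity-transfer cosine
`⟪−u′, ψ₁⟫/‖u′‖ = 0.99991 / 0.9999934 / 0.99999972 / 0.99999993` at `a = 0.55 / 0.70 / 1.00 / 1.20`
(`N = 60/50/50/50`; `N = 80` at `a = 1.00`: `0.99999967`); `K = ‖u′‖² = 14.14 / 12.78 / 11.43 / 10.98`;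
`μ_geom = 1.73905e-2 / 1.94684e-2 / 2.18499e-2 / 2.27504e-2` against `1/(4K) = 1.7683e-2 / 1.9561e-2 / 2.1872e-2 /
2.2762e-2` (relative defect `1.7e-2 / 4.7e-3 / 1.1e-3 / 5e-4`, decreasing with `a`, of the size of the bound);
`p = 0.8077 / 0.8309 / 0.8572 / 0.8666`, `⟪σ, ψ₁⟫ = 0.10562 / 0.11566 / 0.12664 / 0.13069 ≈ p/(2‖u′‖)`; the
measured saturation `t*/WALL = 0.97863` (`a = 1.00`, `N = 40, 60, 80, 100`: N-independent to `1e-6`) against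
`4K/(1 + 4K) = 0.97860`.  The odd ground state `ψ₁` is one-signed on `(0, a)` at every window tested, and
`Q⁻ψ₁ = ε₁⁻ψ₁` with `Q⁻ = A₀⁻ + 2|σ⟩⟨σ|` holds to `1e-61`.

Reading for the cell (mechanism (ii), where the `97.8 %` comes from): the even ground state loses nothing to the
polar data — the saturation deficit `1 − t*/WALL = 1/(1 + 4K)` is set by the KINETIC ENERGY of `u_a` alone, and
`K ≈ 11 – 14` (`4.6×` the `(π/2a)²` of a cosine bump at `a = 1.0`) is carried by the CENTRAL CORE of `u_a`, not by
an edge layer: the even ground state is a bump of roughly window-independent width (half-height at `|x| ≈ 0.25`,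
steepest slope at `|x| ≈ 0.23`, for `a = 0.7` and `a = 1.0`; `99 %` of `K` inside `|x| < a/2` at `a = 1.0`) whose
exponentially small tail reaches the edge (`u(0.9a)/u(0) = 4e-4 / 4e-8` at `a = 0.7 / 1.0`).  Nothing here proves
one-signedness.

References: P. Clément, L. A. Peletier, J. Differential Equations 34 (1979) 218–229; E. Bombieri, Rend. Mat. Acc.
Lincei (9) 11 (2000) 183–233, Thm 2; H. Chen, T. Weth, Comm. PDE 44 (2019) 1100–1139 (the logarithmic Laplacian,
principal part of the archimedean window form).
-/

set_option linter.dupNamespace false  -- the mandated namespace repeats `RiemannHypothesis`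

noncomputable section

namespace Summit.RiemannHypothesis.RiemannHypothesis.Theorems.PolarPerronFrobenius

open scoped InnerProductSpace

variable {E : Type*} [NormedAddCommGroup E] [InnerProductSpace ℝ E]
variable {F : Type*} [NormedAddCommGroup F] [InnerProductSpace ℝ F]

section kinetic

variable {c d u : E} {σ w : F} {D : F →ₗ[ℝ] E} {sh : ℝ}

/-- **PROVED — KINETIC ENERGY.** Under (R2) (`w = −u′` in weak form), `⟪u, Dw⟫ = ‖w‖²`: the pairing of the even
ground state with the derivative of its own derivative is its Dirichlet energy. [folklore] -/
theorem kinetic_eq (hw : ∀ ψ : F, ⟪u, D ψ⟫_ℝ = ⟪w, ψ⟫_ℝ) : ⟪u, D w⟫_ℝ = ‖w‖ ^ 2 := by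
  rw [hw w, real_inner_self_eq_norm_sq]

/-- **PROVED — THE ODD POLAR OVERLAP OF `−u′`.** Under (R2) and (R3):
`⟪σ, w⟫ = ½⟪c, u⟫ − 2·sh·⟪δ_a, u⟫` (integration by parts of `⟪sinh ½x, −u′⟫`). [folklore] -/
theorem inner_oddPolar_transfer (hw : ∀ ψ : F, ⟪u, D ψ⟫_ℝ = ⟪w, ψ⟫_ℝ)
    (hDσ : D σ = (1 / 2 : ℝ) • c - (2 * sh) • d) :
    ⟪σ, w⟫_ℝ = 1 / 2 * ⟪c, u⟫_ℝ - 2 * sh * ⟪d, u⟫_ℝ := by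
  rw [real_inner_comm w σ, ← hw σ, hDσ, inner_sub_right, real_inner_smul_right, real_inner_smul_right,
    real_inner_comm c u, real_inner_comm d u]

/-- **PROVED — μ_geom AS A POLAR RATIO.** Under (R1) and (R2):
`−‖u‖²⟪c, Dψ⟫/(p⟪Dψ, u⟫) = ‖u‖²⟪σ, ψ⟫/(2p⟪w, ψ⟫)`. [folklore] -/
theorem muGeom_eq_polarRatio (hσ : ∀ ψ : F, ⟪c, D ψ⟫_ℝ = -(1 / 2) * ⟪σ, ψ⟫_ℝ)
    (hw : ∀ ψ : F, ⟪u, D ψ⟫_ℝ = ⟪w, ψ⟫_ℝ) (ψ : F) :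
    -(⟪u, u⟫_ℝ * ⟪c, D ψ⟫_ℝ) / (⟪c, u⟫_ℝ * ⟪D ψ, u⟫_ℝ)
      = ⟪u, u⟫_ℝ * ⟪σ, ψ⟫_ℝ / (2 * (⟪c, u⟫_ℝ * ⟪w, ψ⟫_ℝ)) := by
  rw [hσ ψ, real_inner_comm u (D ψ), hw ψ,
    show -(⟪u, u⟫_ℝ * (-(1 / 2) * ⟪σ, ψ⟫_ℝ)) = ⟪u, u⟫_ℝ * ⟪σ, ψ⟫_ℝ / 2 by ring, div_div]

/-- **PROVED — THE TRANSFER-DEFECT IDENTITY.** Under (R1)–(R3), write the odd vector as `ψ = t·w + r` with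
`⟪w, r⟫ = 0` (`t ≠ 0`, `w ≠ 0`, `p = ⟪c, u⟫ ≠ 0`).  Then
`μ_geom · 4‖w‖² = ‖u‖²·(1 − 4·sh·⟪δ_a, u⟫/p + 2⟪σ, r⟫/(t·p))` exactly. [folklore] -/
theorem muGeom_transfer_defect (hσ : ∀ ψ : F, ⟪c, D ψ⟫_ℝ = -(1 / 2) * ⟪σ, ψ⟫_ℝ)
    (hw : ∀ ψ : F, ⟪u, D ψ⟫_ℝ = ⟪w, ψ⟫_ℝ) (hDσ : D σ = (1 / 2 : ℝ) • c - (2 * sh) • d)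
    {ψ r : F} {t : ℝ} (hψ : ψ = t • w + r) (hr : ⟪w, r⟫_ℝ = 0) (ht : t ≠ 0) (hw0 : w ≠ 0)
    (hp : ⟪c, u⟫_ℝ ≠ 0) :
    -(⟪u, u⟫_ℝ * ⟪c, D ψ⟫_ℝ) / (⟪c, u⟫_ℝ * ⟪D ψ, u⟫_ℝ) * (4 * ‖w‖ ^ 2)
      = ⟪u, u⟫_ℝ * (1 - 4 * sh * ⟪d, u⟫_ℝ / ⟪c, u⟫_ℝ + 2 * ⟪σ, r⟫_ℝ / (t * ⟪c, u⟫_ℝ)) := by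
  have hS : ⟪σ, ψ⟫_ℝ = t * (1 / 2 * ⟪c, u⟫_ℝ - 2 * sh * ⟪d, u⟫_ℝ) + ⟪σ, r⟫_ℝ := by
    rw [hψ, inner_add_right, real_inner_smul_right, inner_oddPolar_transfer hw hDσ]
  have hW : ⟪w, ψ⟫_ℝ = t * ‖w‖ ^ 2 := by
    rw [hψ, inner_add_right, real_inner_smul_right, real_inner_self_eq_norm_sq, hr, add_zero]
  have hw2 : ‖w‖ ^ 2 ≠ 0 := pow_ne_zero 2 (norm_ne_zero_iff.mpr hw0)
  rw [muGeom_eq_polarRatio hσ hw, hS, hW]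
  field_simp
  ring

/-- **PROVED — EXACT PARITY TRANSFER ⇒ `μ_geom = ‖u‖²(1 − 4·sh·θ/p)/(4‖w‖²)`.** If the odd ground state is a
multiple of `w = −u′` then, up to the edge term `4·sh·⟪δ_a, u⟫/p`, the weight is `‖u‖²/(4‖u′‖²)`: the inverse of
four times the kinetic energy; the polar overlaps cancel. [folklore] -/
theorem muGeom_transfer_exact (hσ : ∀ ψ : F, ⟪c, D ψ⟫_ℝ = -(1 / 2) * ⟪σ, ψ⟫_ℝ)
    (hw : ∀ ψ : F, ⟪u, D ψ⟫_ℝ = ⟪w, ψ⟫_ℝ) (hDσ : D σ = (1 / 2 : ℝ) • c - (2 * sh) • d)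
    {ψ : F} {t : ℝ} (hψ : ψ = t • w) (ht : t ≠ 0) (hw0 : w ≠ 0) (hp : ⟪c, u⟫_ℝ ≠ 0) :
    -(⟪u, u⟫_ℝ * ⟪c, D ψ⟫_ℝ) / (⟪c, u⟫_ℝ * ⟪D ψ, u⟫_ℝ)
      = ⟪u, u⟫_ℝ * (1 - 4 * sh * ⟪d, u⟫_ℝ / ⟪c, u⟫_ℝ) / (4 * ‖w‖ ^ 2) := by
  have hψ' : ψ = t • w + 0 := by rw [hψ, add_zero]
  have h := muGeom_transfer_defect hσ hw hDσ hψ' (inner_zero_right w) ht hw0 hp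
  rw [inner_zero_right, mul_zero, zero_div, add_zero] at h
  have hw2 : (4 : ℝ) * ‖w‖ ^ 2 ≠ 0 := by
    have := pow_ne_zero 2 (norm_ne_zero_iff.mpr hw0); positivity
  rw [eq_div_iff hw2, h]

/-- **PROVED — THE TRANSFER BOUND.** With the defect decomposition of `muGeom_transfer_defect`:
`|μ_geom·4‖w‖² − ‖u‖²(1 − 4·sh·θ/p)| ≤ 2‖u‖²‖σ‖‖r‖/(|t|·|p|)` (Cauchy–Schwarz on `⟪σ, r⟫`). [folklore] -/
theorem muGeom_transfer_bound (hσ : ∀ ψ : F, ⟪c, D ψ⟫_ℝ = -(1 / 2) * ⟪σ, ψ⟫_ℝ)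
    (hw : ∀ ψ : F, ⟪u, D ψ⟫_ℝ = ⟪w, ψ⟫_ℝ) (hDσ : D σ = (1 / 2 : ℝ) • c - (2 * sh) • d)
    {ψ r : F} {t : ℝ} (hψ : ψ = t • w + r) (hr : ⟪w, r⟫_ℝ = 0) (ht : t ≠ 0) (hw0 : w ≠ 0)
    (hp : ⟪c, u⟫_ℝ ≠ 0) :
    |-(⟪u, u⟫_ℝ * ⟪c, D ψ⟫_ℝ) / (⟪c, u⟫_ℝ * ⟪D ψ, u⟫_ℝ) * (4 * ‖w‖ ^ 2)
        - ⟪u, u⟫_ℝ * (1 - 4 * sh * ⟪d, u⟫_ℝ / ⟪c, u⟫_ℝ)|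
      ≤ 2 * ⟪u, u⟫_ℝ * ‖σ‖ * ‖r‖ / (|t| * |⟪c, u⟫_ℝ|) := by
  rw [muGeom_transfer_defect hσ hw hDσ hψ hr ht hw0 hp]
  have huu : 0 ≤ ⟪u, u⟫_ℝ := real_inner_self_nonneg
  have htp : 0 < |t| * |⟪c, u⟫_ℝ| := mul_pos (abs_pos.mpr ht) (abs_pos.mpr hp)
  have hcs : |⟪σ, r⟫_ℝ| ≤ ‖σ‖ * ‖r‖ := abs_real_inner_le_norm σ r
  have key : ⟪u, u⟫_ℝ * (1 - 4 * sh * ⟪d, u⟫_ℝ / ⟪c, u⟫_ℝ + 2 * ⟪σ, r⟫_ℝ / (t * ⟪c, u⟫_ℝ))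
      - ⟪u, u⟫_ℝ * (1 - 4 * sh * ⟪d, u⟫_ℝ / ⟪c, u⟫_ℝ)
      = 2 * ⟪u, u⟫_ℝ * ⟪σ, r⟫_ℝ / (t * ⟪c, u⟫_ℝ) := by ring
  rw [key, abs_div, abs_mul t, show |2 * ⟪u, u⟫_ℝ * ⟪σ, r⟫_ℝ| = 2 * ⟪u, u⟫_ℝ * |⟪σ, r⟫_ℝ| by
    rw [abs_mul, abs_of_nonneg (by positivity : (0:ℝ) ≤ 2 * ⟪u, u⟫_ℝ)]]
  rw [div_le_div_iff_of_pos_right htp]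
  have : 2 * ⟪u, u⟫_ℝ * |⟪σ, r⟫_ℝ| ≤ 2 * ⟪u, u⟫_ℝ * (‖σ‖ * ‖r‖) :=
    mul_le_mul_of_nonneg_left hcs (by positivity)
  linarith

end kinetic



end Summit.RiemannHypothesis.RiemannHypothesis.Theorems.PolarPerronFrobenius

end
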